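import Literature.Computability.QuantumComplexity.ForrelationDerivativeTables
import Literature.Computability.QuantumComplexity.ForrelationDirectSum

/-!
# Crux `CubicForrelation.SignedCubicForrelationNotPrBPP` (stmt-QuantumAdvantage-13931)

Stub `stub_quarterIdentity` of the line `Sketch` (K1, the QUARTER IDENTITY of card `kernel-descent`).

For a Boolean function on `n + 2` bits in KERNEL FORM
`b(x₀, x₁, x″) = (x₁ ⊕ c₀)·(x₀ ⊕ B₁(x″)) ⊕ B₀(x″)` and ANY Boolean `a` on `n + 2` bits,

  `Φ(a, b) = ¼ · Σ_{q₀ q₁ ∈ 𝔽₂} Φ(a_q ⊕ q₀q₁ ⊕ q₁c₀, B₀ ⊕ q₀B₁)`,  `a_q(u) = a(q₀, q₁, u)`,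

exactly (no degree or bentness hypothesis). Proof: the unnormalised Walsh transform of `(-1)^b`
splits over the first two coordinates; summing the four values of `(y₀, y₁)` for fixed `y″` is a
32-case 𝔽₂ computation giving `W_b(x₀, x₁, x″) = 2 (-1)^{x₀x₁ + x₁c₀} W_{B₀ ⊕ x₀B₁}(x″)`; then the
outer sum over `x = (q₀, q₁, u)` is split the same way and the normalisations compare as
`√(2^{3(n+2)}) = 8 √(2^{3n})`, `8⁻¹ · 2 = ¼`.
-/

noncomputable section

set_option linter.dupNamespace false -- D-0017: single-problem summit ⇒ `QuantumAdvantage.QuantumAdvantage` by design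

namespace Summit.QuantumAdvantage.QuantumAdvantage.Theorems.SignedCubicForrelationNotPrBPP

open Literature.Computability.QuantumComplexity Literature.Computability.Complexity
open Literature.Computability.QuantumComplexity.BuzetChailloux (bxor zeroVec phi phi_signOf)
open Literature.Computability.QuantumComplexity.DerivativeWalsh (W fsum_eq_sum_mul_W phi_eq_fsum)

/-- Splitting a sum over `Fin (k+1) → Bool` along the first coordinate (`Fin.consEquiv`). -/
private theorem stub_quarterIdentity_sum_cons (k : ℕ) (g : (Fin (k + 1) → Bool) → ℝ) :
    ∑ x, g x = ∑ p : Bool, ∑ u : Fin k → Bool, g (Fin.cons p u) := by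
  rw [← Fintype.sum_equiv (Fin.consEquiv fun _ => Bool) (fun y => g (Fin.cons y.1 y.2)) g
      (fun _ => rfl), Fintype.sum_prod_type]

/-- Splitting a sum over `Fin (k+2) → Bool`: the first two coordinates outermost. -/
private theorem stub_quarterIdentity_sum_outer (k : ℕ) (g : (Fin (k + 2) → Bool) → ℝ) :
    ∑ x, g x = ∑ p : Bool, ∑ q : Bool, ∑ u : Fin k → Bool, g (Fin.cons p (Fin.cons q u)) := by
  simp only [stub_quarterIdentity_sum_cons]

/-- Splitting a sum over `Fin (k+2) → Bool`: the tail outermost, the first two coordinates inside. -/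
private theorem stub_quarterIdentity_sum_inner (k : ℕ) (g : (Fin (k + 2) → Bool) → ℝ) :
    ∑ x, g x = ∑ u : Fin k → Bool, ∑ p : Bool, ∑ q : Bool, g (Fin.cons p (Fin.cons q u)) := by
  calc ∑ x, g x = ∑ p : Bool, ∑ q : Bool, ∑ u : Fin k → Bool, g (Fin.cons p (Fin.cons q u)) :=
        stub_quarterIdentity_sum_outer k g
    _ = ∑ p : Bool, ∑ u : Fin k → Bool, ∑ q : Bool, g (Fin.cons p (Fin.cons q u)) :=
        Finset.sum_congr rfl fun _ _ => Finset.sum_comm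
    _ = ∑ u : Fin k → Bool, ∑ p : Bool, ∑ q : Bool, g (Fin.cons p (Fin.cons q u)) := Finset.sum_comm

/-- The twist factors over the first coordinate: `(-1)^{(p∷u)·(q∷v)} = (-1)^{pq} · (-1)^{u·v}`. -/
private theorem stub_quarterIdentity_twist_cons {k : ℕ} (p q : Bool) (u v : Fin k → Bool) :
    twist (Fin.cons p u : Fin (k + 1) → Bool) (Fin.cons q v) = signOf (p && q) * twist u v := by
  unfold twist signOf
  rw [Fin.prod_univ_succ]
  simp only [Fin.cons_zero, Fin.cons_succ]

/-- The `𝔽₂` computation at the heart of the quarter identity: for fixed bits `x₀ x₁ c₀ β₁ β₀`,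
`Σ_{p q} (-1)^{((q ⊕ c₀)(p ⊕ β₁)) ⊕ β₀} (-1)^{p x₀} (-1)^{q x₁} = 2 (-1)^{x₀x₁} (-1)^{x₁c₀} (-1)^{β₀ ⊕ x₀β₁}`
(the `q = c₀` terms give `2[x₀ = 0] (-1)^{c₀x₁} (-1)^{β₀}`, the `q = ¬c₀` terms
`2[x₀ = 1] (-1)^{(¬c₀)x₁} (-1)^{β₀ ⊕ β₁}`). -/
private theorem stub_quarterIdentity_kernel (x₀ x₁ c₀ β₁ β₀ : Bool) :
    ∑ p : Bool, ∑ q : Bool,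
        signOf (((q ^^ c₀) && (p ^^ β₁)) ^^ β₀) * (signOf (p && x₀) * signOf (q && x₁)) =
      2 * (signOf (x₀ && x₁) * signOf (x₁ && c₀)) * signOf (β₀ ^^ (x₀ && β₁)) := by
  simp only [Fintype.sum_bool]
  cases x₀ <;> cases x₁ <;> cases c₀ <;> cases β₁ <;> cases β₀ <;> norm_num [signOf]

/-- `√(2^{3(n+2)}) = 8 · √(2^{3n})`. -/
private theorem stub_quarterIdentity_sqrt (n : ℕ) :
    Real.sqrt ((2 : ℝ) ^ (3 * (n + 2))) = 8 * Real.sqrt ((2 : ℝ) ^ (3 * n)) := by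
  rw [sqrt_two_pow_three_mul_add n 2, mul_comm]
  congr 1
  rw [show ((2 : ℝ)) ^ (3 * 2) = 8 ^ 2 by norm_num]
  exact Real.sqrt_sq (by norm_num)

/-- QUARTER IDENTITY (stub `stub_quarterIdentity` = K1 of line `Sketch`, crux stmt-QuantumAdvantage-13931).
For `b(x₀,x₁,x″) = (x₁ ⊕ c₀)·(x₀ ⊕ B₁(x″)) ⊕ B₀(x″)` on `n + 2` bits and EVERY `a`:
`Φ(a,b) = ¼ Σ_{q₀,q₁} Φ(a_q ⊕ q₀q₁ ⊕ q₁c₀, B₀ ⊕ q₀B₁)`, `a_q(u) = a(q₀,q₁,u)`. Exact; no degree or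
bentness hypothesis. Via `W_b(x₀,x₁,x″) = 2 (-1)^{x₀x₁ + x₁c₀} W_{B₀ ⊕ x₀B₁}(x″)` and
`√(2^{3(n+2)}) = 8 √(2^{3n})`. -/
theorem stub_quarterIdentity :
    ∀ (n : ℕ) (a : (Fin (n + 2) → Bool) → Bool) (B₀ B₁ : (Fin n → Bool) → Bool) (c₀ : Bool),
      forrelation a
          (fun x => ((x 1 ^^ c₀) && (x 0 ^^ B₁ (Fin.tail (Fin.tail x)))) ^^ B₀ (Fin.tail (Fin.tail x))) =
        (1 / 4 : ℝ) * ∑ q₀ : Bool, ∑ q₁ : Bool,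
          forrelation (fun u => (a (Fin.cons q₀ (Fin.cons q₁ u)) ^^ (q₀ && q₁)) ^^ (q₁ && c₀))
            (fun u => B₀ u ^^ (q₀ && B₁ u)) := by
  intro n a B₀ B₁ c₀
  set b : (Fin (n + 2) → Bool) → Bool :=
    fun x => ((x 1 ^^ c₀) && (x 0 ^^ B₁ (Fin.tail (Fin.tail x)))) ^^ B₀ (Fin.tail (Fin.tail x)) with hb
  -- the unnormalised Walsh transform of `(-1)^b` at `(x₀, x₁, u)`
  have hW : ∀ (x₀ x₁ : Bool) (u : Fin n → Bool),
      W (fun y => signOf (b y)) (Fin.cons x₀ (Fin.cons x₁ u)) =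
        2 * (signOf (x₀ && x₁) * signOf (x₁ && c₀)) * W (fun v => signOf (B₀ v ^^ (x₀ && B₁ v))) u := by
    intro x₀ x₁ u
    unfold W
    rw [stub_quarterIdentity_sum_inner, Finset.mul_sum]
    refine Finset.sum_congr rfl fun v _ => ?_
    simp only [hb, Fin.cons_zero, Fin.cons_one, Fin.tail_cons, stub_quarterIdentity_twist_cons]
    have hk := stub_quarterIdentity_kernel x₀ x₁ c₀ (B₁ v) (B₀ v)
    simp only [Fintype.sum_bool] at hk ⊢
    linear_combination twist v u * hk
  -- both sides as sums over `(q₀, q₁, u)` of `(-1)^{a} · W`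
  rw [← phi_signOf, phi_eq_fsum, fsum_eq_sum_mul_W, stub_quarterIdentity_sum_outer]
  simp only [hW]
  simp only [← phi_signOf, phi_eq_fsum, fsum_eq_sum_mul_W, signOf_xor]
  -- normalisation: `(8 √(2^{3n}))⁻¹ · 2 = ¼ · (√(2^{3n}))⁻¹`
  rw [stub_quarterIdentity_sqrt n]
  simp only [Finset.mul_sum]
  refine Finset.sum_congr rfl fun q₀ _ => Finset.sum_congr rfl fun q₁ _ =>
    Finset.sum_congr rfl fun u _ => ?_
  ring

end Summit.QuantumAdvantage.QuantumAdvantage.Theorems.SignedCubicForrelationNotPrBPP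

end
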